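import Mathlib
import HarnessLib
import Summits.ValiantsHypothesis.ValiantsHypothesis.Theorems.LacunarySymmetroidMatrixDescartesProductPlusOneRateSeparatedCell
import Summits.ValiantsHypothesis.ValiantsHypothesis.Theorems.LacunarySymmetroidMatrixDescartesProductPlusOneGlobalCells

/-!
# LINE (A) `product_plus_one` (crux `MatrixDescartes`, stmt-ValiantsHypothesis-18050, V1) — EB2-W in its OWN currency, part 3:
# the RATE-SEPARATED BINOMIAL CLASS at every threshold, globally (`Z₊(W(∏ f_j)) ≤ 3·m + 2`, window-free)

✓/⧗ `…RateSeparatedCell` gives the per-window cell (threshold `ρ : ℕ`: knee binomials of rate `≤ ρ` on any pair, pole binomials of rate `≥ ρ` on any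
pair, `0 ≤ f(u)f(v)` ⇒ at most two roots of `W(∏ f_j)` in `(u,v)`), ✓/⧗ `…GlobalCells` the window-assembly shell.  Here:

* ★★ `rateSeparated_wronskian_card_le` — `K = 3`, `d 0 < d 1 < d 2`, EVERY `m`, every threshold `ρ`: the binomial menu WITHOUT window conditions ⇒
  `Z₊(W(∏_j f_j)) ≤ 3·m + 2` (window conditions discharged by the intermediate value theorem on the extended root-free window);
* ★ `allKnees_fastPoles_wronskian_card_le` — the instance `ρ = d2 − d0`: ANY number of knee binomials on ALL THREE pairs (all rates at once) against pole
  binomials on the fast pair `(d0,d2)` ⇒ `≤ 3·m + 2`;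
* `rateSeparated_eulerNumerator_card_le` — Euler twin `Z₊(eulerNumerator d a l₀) ≤ 5·m + 3` at EVERY coupling
  (✓ `card_posRoots_eulerNumerator_le_wronskian_add_of_oneChange`): the floor inequality of `OneChangeFloorK3` on this class.

`ρ = d1 − d0` recovers ✓/⧗ `slowKneeBinomial_wronskian_card_le` (part 1).  HONEST FRAMING: bookkeeping on BINOMIAL companies under rate separation
(p8 g17 memo §2 RATE-SEPARATED LAW, p5 g16 E4⁺ engine); the located per-window extremisers (fast knees between slow poles) violate the hypothesis;
`WronskianBudgetK3`, `OneChangeFloorK3`, `stub_classRowK3`, `stub_eulerBoundK3`, `stub_polyLaw`, `MatrixDescartes` (18050), Conjecture B are NOT proved;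
`VP ≠ VNP` is NOT proved.  No definitions, no named facts, no sorry; Mathlib + ✓ lane modules only.
-/

set_option linter.dupNamespace false

namespace Summit.ValiantsHypothesis.ValiantsHypothesis.Theorems.LacunarySymmetroidMatrixDescartes

namespace ProductPlusOne

open Finset Set Polynomial
open scoped BigOperators Topology Polynomial

/-! ### §2 The rate-separated class, globally -/

section Global

variable {m : ℕ} (d : Fin 3 → ℕ) (a : Fin m → Fin 3 → ℝ)

/-- The rows of the rate-separated binomial class are one-change rows. [folklore] -/
theorem rateSeparated_oneChange (ρ : ℕ)
    (hrow : ∀ j,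
      (a j 2 = 0 ∧ 0 < a j 0 * a j 1 ∧ d 1 - d 0 ≤ ρ) ∨ (a j 2 = 0 ∧ a j 0 * a j 1 < 0 ∧ ρ ≤ d 1 - d 0) ∨
      (a j 0 = 0 ∧ 0 < a j 1 * a j 2 ∧ d 2 - d 1 ≤ ρ) ∨ (a j 0 = 0 ∧ a j 1 * a j 2 < 0 ∧ ρ ≤ d 2 - d 1) ∨
      (a j 1 = 0 ∧ 0 < a j 0 * a j 2 ∧ d 2 - d 0 ≤ ρ) ∨ (a j 1 = 0 ∧ a j 0 * a j 2 < 0 ∧ ρ ≤ d 2 - d 0)) :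
    ∀ j, ¬ (a j 0 * a j 1 < 0 ∧ a j 1 * a j 2 < 0) := by
  intro j
  rcases hrow j with h | h | h | h | h | h
  · exact not_dip_of_zero_letter (Or.inr (Or.inr h.1))
  · exact not_dip_of_zero_letter (Or.inr (Or.inr h.1))
  · exact not_dip_of_zero_letter (Or.inl h.1)
  · exact not_dip_of_zero_letter (Or.inl h.1)
  · exact not_dip_of_zero_letter (Or.inr (Or.inl h.1))
  · exact not_dip_of_zero_letter (Or.inr (Or.inl h.1))

/-- ★★ **EB2-W ON THE RATE-SEPARATED BINOMIAL CLASS** (`K = 3`, `d 0 < d 1 < d 2`, every `m`, window-free): for a threshold `ρ : ℕ`, if every row is a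
knee binomial (any pair) of rate `≤ ρ` or a pole binomial (any pair) of rate `≥ ρ`, then `Z₊(W(∏_j f_j)) ≤ 3·m + 2`. [this file's theorem] -/
theorem rateSeparated_wronskian_card_le (h01 : d 0 < d 1) (h12 : d 1 < d 2) (ρ : ℕ)
    (hrow : ∀ j,
      (a j 2 = 0 ∧ 0 < a j 0 * a j 1 ∧ d 1 - d 0 ≤ ρ) ∨ (a j 2 = 0 ∧ a j 0 * a j 1 < 0 ∧ ρ ≤ d 1 - d 0) ∨
      (a j 0 = 0 ∧ 0 < a j 1 * a j 2 ∧ d 2 - d 1 ≤ ρ) ∨ (a j 0 = 0 ∧ a j 1 * a j 2 < 0 ∧ ρ ≤ d 2 - d 1) ∨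
      (a j 1 = 0 ∧ 0 < a j 0 * a j 2 ∧ d 2 - d 0 ≤ ρ) ∨ (a j 1 = 0 ∧ a j 0 * a j 2 < 0 ∧ ρ ≤ d 2 - d 0)) :
    (((∏ j, ∑ l, C (a j l) * X ^ (d l) : ℝ[X]) * (X * derivative (X * derivative (∏ j, ∑ l, C (a j l) * X ^ (d l) : ℝ[X])))
        - (X * derivative (∏ j, ∑ l, C (a j l) * X ^ (d l) : ℝ[X])) ^ 2).roots.toFinset.filter (fun t => 0 < t)).card ≤ 3 * m + 2 := by
  classical
  set P : ℝ[X] := ∏ j, ∑ l, C (a j l) * X ^ (d l) with hPdef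
  by_cases hP : P = 0
  · rw [wronskian_card_eq_zero_of_prod_eq_zero d a hP]; exact Nat.zero_le _
  rcases Nat.eq_zero_or_pos m with hm0 | hm
  · subst hm0
    have h1 : P = 1 := by rw [hPdef]; simp
    rw [h1]; simp
  have hone := rateSeparated_oneChange d a ρ hrow
  have hZP : (P.roots.toFinset.filter (fun t => 0 < t)).card ≤ m := by
    rw [hPdef]; exact card_posRoots_prod_le_of_oneChange d h01 h12 a hone
  refine (card_posRoots_le_of_threePoint P _ hP ?_).trans (by omega)
  intro x₁ x₂ x₃ hx₁ h12' h23 hW₁ hW₂ hW₃ hfreeI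
  have hfree' : ∀ r ∈ P.roots.toFinset.filter (fun t => 0 < t), ¬ (x₁ ≤ r ∧ r ≤ x₃) := by
    intro r hr hrI
    rw [Finset.mem_filter, Multiset.mem_toFinset, mem_roots hP] at hr
    exact hfreeI r ⟨hrI.1, hrI.2⟩ hr.1
  obtain ⟨u, v, hu, hux, hxv, hfree⟩ := exists_window_extension _ hx₁ (h12'.trans h23).le hfree'
  have hrowfree := row_eval_ne_zero_of_free (fun j => (∑ l, C (a j l) * X ^ (d l) : ℝ[X])) hP hu hfree
  have hsign : ∀ j, 0 ≤ (∑ l, C (a j l) * X ^ (d l) : ℝ[X]).eval u * (∑ l, C (a j l) * X ^ (d l) : ℝ[X]).eval v := fun j =>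
    (eval_mul_eval_pos_of_no_root _ (by linarith) (hrowfree j)).le
  refine rateSeparated_wronskian_no_three_zeros hm d h01 h12 ρ a hu (fun j => ?_) (x₁ := x₁) (x₂ := x₂) (x₃ := x₃)
    ⟨hux, by linarith⟩ ⟨by linarith, hxv⟩ h12' h23 ?_
  · rcases hrow j with h | h | h | h | h | h
    · exact Or.inl h
    · exact Or.inr (Or.inl ⟨h.1, h.2.1, h.2.2, hsign j⟩)
    · exact Or.inr (Or.inr (Or.inl h))
    · exact Or.inr (Or.inr (Or.inr (Or.inl ⟨h.1, h.2.1, h.2.2, hsign j⟩)))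
    · exact Or.inr (Or.inr (Or.inr (Or.inr (Or.inl h))))
    · exact Or.inr (Or.inr (Or.inr (Or.inr (Or.inr ⟨h.1, h.2.1, h.2.2, hsign j⟩))))
  · intro x hx
    simp only [Set.mem_insert_iff, Set.mem_singleton_iff] at hx
    rcases hx with rfl | rfl | rfl
    · exact hW₁
    · exact hW₂
    · exact hW₃

/-- ★ **ALL KNEES AGAINST FAST POLES** (the threshold `ρ = d2 − d0`): any number of knee binomials on ANY of the three pairs (all three rates at once) and
pole binomials on the fast pair `(d0,d2)` ⇒ `Z₊(W(∏_j f_j)) ≤ 3·m + 2`. [this file's theorem] -/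
theorem allKnees_fastPoles_wronskian_card_le (h01 : d 0 < d 1) (h12 : d 1 < d 2)
    (hrow : ∀ j, (a j 2 = 0 ∧ 0 < a j 0 * a j 1) ∨ (a j 0 = 0 ∧ 0 < a j 1 * a j 2) ∨ (a j 1 = 0 ∧ 0 < a j 0 * a j 2) ∨
      (a j 1 = 0 ∧ a j 0 * a j 2 < 0)) :
    (((∏ j, ∑ l, C (a j l) * X ^ (d l) : ℝ[X]) * (X * derivative (X * derivative (∏ j, ∑ l, C (a j l) * X ^ (d l) : ℝ[X])))
        - (X * derivative (∏ j, ∑ l, C (a j l) * X ^ (d l) : ℝ[X])) ^ 2).roots.toFinset.filter (fun t => 0 < t)).card ≤ 3 * m + 2 := by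
  refine rateSeparated_wronskian_card_le d a h01 h12 (d 2 - d 0) fun j => ?_
  rcases hrow j with h | h | h | h
  · exact Or.inl ⟨h.1, h.2, by omega⟩
  · exact Or.inr (Or.inr (Or.inl ⟨h.1, h.2, by omega⟩))
  · exact Or.inr (Or.inr (Or.inr (Or.inr (Or.inl ⟨h.1, h.2, le_rfl⟩))))
  · exact Or.inr (Or.inr (Or.inr (Or.inr (Or.inr ⟨h.1, h.2, le_rfl⟩))))

/-- **Floor inequality on the rate-separated binomial class**: `Z₊(eulerNumerator d a l₀) ≤ 5·m + 3` for every coupling `l₀` and threshold `ρ`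
(✓ `card_posRoots_eulerNumerator_le_wronskian_add_of_oneChange` + `rateSeparated_wronskian_card_le`). [this file's theorem] -/
theorem rateSeparated_eulerNumerator_card_le (h01 : d 0 < d 1) (h12 : d 1 < d 2) (ρ : ℕ)
    (hrow : ∀ j,
      (a j 2 = 0 ∧ 0 < a j 0 * a j 1 ∧ d 1 - d 0 ≤ ρ) ∨ (a j 2 = 0 ∧ a j 0 * a j 1 < 0 ∧ ρ ≤ d 1 - d 0) ∨
      (a j 0 = 0 ∧ 0 < a j 1 * a j 2 ∧ d 2 - d 1 ≤ ρ) ∨ (a j 0 = 0 ∧ a j 1 * a j 2 < 0 ∧ ρ ≤ d 2 - d 1) ∨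
      (a j 1 = 0 ∧ 0 < a j 0 * a j 2 ∧ d 2 - d 0 ≤ ρ) ∨ (a j 1 = 0 ∧ a j 0 * a j 2 < 0 ∧ ρ ≤ d 2 - d 0))
    (l₀ : Fin 3) :
    ((∑ j, (∑ l, C (a j l * ((d l : ℝ) - d l₀)) * X ^ (d l)) * ∏ i ∈ Finset.univ.erase j, (∑ l, C (a i l) * X ^ (d l))
        : ℝ[X]).roots.toFinset.filter (fun t => 0 < t)).card ≤ 5 * m + 3 := by
  have h1 := card_posRoots_eulerNumerator_le_wronskian_add_of_oneChange d h01 h12 a (rateSeparated_oneChange d a ρ hrow) l₀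
  have h2 := rateSeparated_wronskian_card_le d a h01 h12 ρ hrow
  omega

end Global

end ProductPlusOne

end Summit.ValiantsHypothesis.ValiantsHypothesis.Theorems.LacunarySymmetroidMatrixDescartes
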